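import Summits.Ventures.YMGap.RobustBall.RobustAreaLawVertexW
import HarnessLib

/-!
# Robust ball (Y2), area-law side — the certified FRONTIER of the tier-2 vertex door for `SU(2)`, `d = 3`, `κ = log(6/5)` (the Y4-side balls)

HONEST FRAMING: venture file of the cell `pub-ymgap` (QuantumFields programme), track ROBUST-BALL (ds-4).  ROWS only: the largest one-parameter
radius `ε` (resolution `1/1000`) certified by the `d = 3` affine-vertex tier-2 door `su2_areaLawOnBallW_dim3_vertex_of_row`
(`rhoFR 2 (e^{κ/2}·β_W) (2ε) ε < 1`, slice dimension `2`, slab radius `β_W ≤ 1`) under `(6/5)^{1/2} ≤ 1.0955`, `e^{2ε} ≤ T₄(2ε)`, `√2 ≤ 1.41422`: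
`(β_W, ε) = (1/8, .462) (1/5, .377) (1/4, .322) (3/10, .271) (1/3, .242) (2/5, .193) (1/2, .137) (3/5, .093) (2/3, .068) (3/4, .042) (4/5, .027)
(7/8, .008)`; the weighted door closes at `e^{κ/2}β_W = 1`, `β_W ≈ .913`.  Each cell: Wilson's AREA LAW uniformly on
`ClusterDomain (log 6/5) (2ε) ε ∩ IsSlabLocal mv` on every torus `(ℤ/L)³`.  Strong-coupling finite-lattice statements; nothing about the continuum or Clay.
-/

noncomputable section

open MeasureTheory ProbabilityTheory Real

namespace Summit.Ventures.YMGap.RobustBall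

/-- `d = 3` tier-2 vertex FRONTIER cell `(β_W, ε) = (1 / 8, .462)` at `κ = log(6/5)`: `AreaLawOnBallW 2 3 (1 / 16) (log(6/5)) (231 / 250) (231 / 500) mv`,
every `mv ≥ 1`; `ε` maximal at `1/1000` under the certificate form. [folklore] -/
theorem su2_areaLawOnBallW_dim3_frontier_oneEighth {mv : ℕ} (hmv : 1 ≤ mv) :
    AreaLawOnBallW 2 3 (1 / 16) (Real.log (6 / 5)) (231 / 250) (231 / 500) mv := by
  have h := su2_areaLawOnBallW_dim3_vertex_of_row (βW := 1 / 8) (ε₀ := 231 / 250) (ε₁ := 231 / 500) (by norm_num) (by norm_num)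
    (Real.log_pos (by norm_num)) (by norm_num) hmv
    (rhoFR_two_lt_one_of_bounds (by norm_num) (by norm_num) exp_log_six_fifths_div_two_le
      (exp_le_taylor4 (x := 231 / 250) (by norm_num) (by norm_num)) sqrt_two_le (by norm_num) (by norm_num))
  rw [show (1 / 8 / 2 : ℝ) = 1 / 16 by norm_num] at h
  exact h

/-- `d = 3` tier-2 vertex FRONTIER cell `(β_W, ε) = (1 / 5, .377)` at `κ = log(6/5)`: `AreaLawOnBallW 2 3 (1 / 10) (log(6/5)) (377 / 500) (377 / 1000) mv`,
every `mv ≥ 1`; `ε` maximal at `1/1000` under the certificate form. [folklore] -/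
theorem su2_areaLawOnBallW_dim3_frontier_oneFifth {mv : ℕ} (hmv : 1 ≤ mv) :
    AreaLawOnBallW 2 3 (1 / 10) (Real.log (6 / 5)) (377 / 500) (377 / 1000) mv := by
  have h := su2_areaLawOnBallW_dim3_vertex_of_row (βW := 1 / 5) (ε₀ := 377 / 500) (ε₁ := 377 / 1000) (by norm_num) (by norm_num)
    (Real.log_pos (by norm_num)) (by norm_num) hmv
    (rhoFR_two_lt_one_of_bounds (by norm_num) (by norm_num) exp_log_six_fifths_div_two_le
      (exp_le_taylor4 (x := 377 / 500) (by norm_num) (by norm_num)) sqrt_two_le (by norm_num) (by norm_num))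
  rw [show (1 / 5 / 2 : ℝ) = 1 / 10 by norm_num] at h
  exact h

/-- `d = 3` tier-2 vertex FRONTIER cell `(β_W, ε) = (1 / 4, .322)` at `κ = log(6/5)`: `AreaLawOnBallW 2 3 (1 / 8) (log(6/5)) (161 / 250) (161 / 500) mv`,
every `mv ≥ 1`; `ε` maximal at `1/1000` under the certificate form. [folklore] -/
theorem su2_areaLawOnBallW_dim3_frontier_oneQuarter {mv : ℕ} (hmv : 1 ≤ mv) :
    AreaLawOnBallW 2 3 (1 / 8) (Real.log (6 / 5)) (161 / 250) (161 / 500) mv := by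
  have h := su2_areaLawOnBallW_dim3_vertex_of_row (βW := 1 / 4) (ε₀ := 161 / 250) (ε₁ := 161 / 500) (by norm_num) (by norm_num)
    (Real.log_pos (by norm_num)) (by norm_num) hmv
    (rhoFR_two_lt_one_of_bounds (by norm_num) (by norm_num) exp_log_six_fifths_div_two_le
      (exp_le_taylor4 (x := 161 / 250) (by norm_num) (by norm_num)) sqrt_two_le (by norm_num) (by norm_num))
  rw [show (1 / 4 / 2 : ℝ) = 1 / 8 by norm_num] at h
  exact h

/-- `d = 3` tier-2 vertex FRONTIER cell `(β_W, ε) = (3 / 10, .271)` at `κ = log(6/5)`: `AreaLawOnBallW 2 3 (3 / 20) (log(6/5)) (271 / 500) (271 / 1000) mv`,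
every `mv ≥ 1`; `ε` maximal at `1/1000` under the certificate form. [folklore] -/
theorem su2_areaLawOnBallW_dim3_frontier_threeTenths {mv : ℕ} (hmv : 1 ≤ mv) :
    AreaLawOnBallW 2 3 (3 / 20) (Real.log (6 / 5)) (271 / 500) (271 / 1000) mv := by
  have h := su2_areaLawOnBallW_dim3_vertex_of_row (βW := 3 / 10) (ε₀ := 271 / 500) (ε₁ := 271 / 1000) (by norm_num) (by norm_num)
    (Real.log_pos (by norm_num)) (by norm_num) hmv
    (rhoFR_two_lt_one_of_bounds (by norm_num) (by norm_num) exp_log_six_fifths_div_two_le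
      (exp_le_taylor4 (x := 271 / 500) (by norm_num) (by norm_num)) sqrt_two_le (by norm_num) (by norm_num))
  rw [show (3 / 10 / 2 : ℝ) = 3 / 20 by norm_num] at h
  exact h

/-- `d = 3` tier-2 vertex FRONTIER cell `(β_W, ε) = (1 / 3, .242)` at `κ = log(6/5)`: `AreaLawOnBallW 2 3 (1 / 6) (log(6/5)) (121 / 250) (121 / 500) mv`,
every `mv ≥ 1`; `ε` maximal at `1/1000` under the certificate form. [folklore] -/
theorem su2_areaLawOnBallW_dim3_frontier_oneThird {mv : ℕ} (hmv : 1 ≤ mv) :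
    AreaLawOnBallW 2 3 (1 / 6) (Real.log (6 / 5)) (121 / 250) (121 / 500) mv := by
  have h := su2_areaLawOnBallW_dim3_vertex_of_row (βW := 1 / 3) (ε₀ := 121 / 250) (ε₁ := 121 / 500) (by norm_num) (by norm_num)
    (Real.log_pos (by norm_num)) (by norm_num) hmv
    (rhoFR_two_lt_one_of_bounds (by norm_num) (by norm_num) exp_log_six_fifths_div_two_le
      (exp_le_taylor4 (x := 121 / 250) (by norm_num) (by norm_num)) sqrt_two_le (by norm_num) (by norm_num))
  rw [show (1 / 3 / 2 : ℝ) = 1 / 6 by norm_num] at h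
  exact h

/-- `d = 3` tier-2 vertex FRONTIER cell `(β_W, ε) = (2 / 5, .193)` at `κ = log(6/5)`: `AreaLawOnBallW 2 3 (1 / 5) (log(6/5)) (193 / 500) (193 / 1000) mv`,
every `mv ≥ 1`; `ε` maximal at `1/1000` under the certificate form. [folklore] -/
theorem su2_areaLawOnBallW_dim3_frontier_twoFifths {mv : ℕ} (hmv : 1 ≤ mv) :
    AreaLawOnBallW 2 3 (1 / 5) (Real.log (6 / 5)) (193 / 500) (193 / 1000) mv := by
  have h := su2_areaLawOnBallW_dim3_vertex_of_row (βW := 2 / 5) (ε₀ := 193 / 500) (ε₁ := 193 / 1000) (by norm_num) (by norm_num)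
    (Real.log_pos (by norm_num)) (by norm_num) hmv
    (rhoFR_two_lt_one_of_bounds (by norm_num) (by norm_num) exp_log_six_fifths_div_two_le
      (exp_le_taylor4 (x := 193 / 500) (by norm_num) (by norm_num)) sqrt_two_le (by norm_num) (by norm_num))
  rw [show (2 / 5 / 2 : ℝ) = 1 / 5 by norm_num] at h
  exact h

/-- `d = 3` tier-2 vertex FRONTIER cell `(β_W, ε) = (1 / 2, .137)` at `κ = log(6/5)`: `AreaLawOnBallW 2 3 (1 / 4) (log(6/5)) (137 / 500) (137 / 1000) mv`,
every `mv ≥ 1`; `ε` maximal at `1/1000` under the certificate form. [folklore] -/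
theorem su2_areaLawOnBallW_dim3_frontier_oneHalf {mv : ℕ} (hmv : 1 ≤ mv) :
    AreaLawOnBallW 2 3 (1 / 4) (Real.log (6 / 5)) (137 / 500) (137 / 1000) mv := by
  have h := su2_areaLawOnBallW_dim3_vertex_of_row (βW := 1 / 2) (ε₀ := 137 / 500) (ε₁ := 137 / 1000) (by norm_num) (by norm_num)
    (Real.log_pos (by norm_num)) (by norm_num) hmv
    (rhoFR_two_lt_one_of_bounds (by norm_num) (by norm_num) exp_log_six_fifths_div_two_le
      (exp_le_taylor4 (x := 137 / 500) (by norm_num) (by norm_num)) sqrt_two_le (by norm_num) (by norm_num))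
  rw [show (1 / 2 / 2 : ℝ) = 1 / 4 by norm_num] at h
  exact h

/-- `d = 3` tier-2 vertex FRONTIER cell `(β_W, ε) = (3 / 5, .093)` at `κ = log(6/5)`: `AreaLawOnBallW 2 3 (3 / 10) (log(6/5)) (93 / 500) (93 / 1000) mv`,
every `mv ≥ 1`; `ε` maximal at `1/1000` under the certificate form. [folklore] -/
theorem su2_areaLawOnBallW_dim3_frontier_threeFifths {mv : ℕ} (hmv : 1 ≤ mv) :
    AreaLawOnBallW 2 3 (3 / 10) (Real.log (6 / 5)) (93 / 500) (93 / 1000) mv := by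
  have h := su2_areaLawOnBallW_dim3_vertex_of_row (βW := 3 / 5) (ε₀ := 93 / 500) (ε₁ := 93 / 1000) (by norm_num) (by norm_num)
    (Real.log_pos (by norm_num)) (by norm_num) hmv
    (rhoFR_two_lt_one_of_bounds (by norm_num) (by norm_num) exp_log_six_fifths_div_two_le
      (exp_le_taylor4 (x := 93 / 500) (by norm_num) (by norm_num)) sqrt_two_le (by norm_num) (by norm_num))
  rw [show (3 / 5 / 2 : ℝ) = 3 / 10 by norm_num] at h
  exact h

/-- `d = 3` tier-2 vertex FRONTIER cell `(β_W, ε) = (2 / 3, .068)` at `κ = log(6/5)`: `AreaLawOnBallW 2 3 (1 / 3) (log(6/5)) (17 / 125) (17 / 250) mv`,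
every `mv ≥ 1`; `ε` maximal at `1/1000` under the certificate form. [folklore] -/
theorem su2_areaLawOnBallW_dim3_frontier_twoThirds {mv : ℕ} (hmv : 1 ≤ mv) :
    AreaLawOnBallW 2 3 (1 / 3) (Real.log (6 / 5)) (17 / 125) (17 / 250) mv := by
  have h := su2_areaLawOnBallW_dim3_vertex_of_row (βW := 2 / 3) (ε₀ := 17 / 125) (ε₁ := 17 / 250) (by norm_num) (by norm_num)
    (Real.log_pos (by norm_num)) (by norm_num) hmv
    (rhoFR_two_lt_one_of_bounds (by norm_num) (by norm_num) exp_log_six_fifths_div_two_le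
      (exp_le_taylor4 (x := 17 / 125) (by norm_num) (by norm_num)) sqrt_two_le (by norm_num) (by norm_num))
  rw [show (2 / 3 / 2 : ℝ) = 1 / 3 by norm_num] at h
  exact h

/-- `d = 3` tier-2 vertex FRONTIER cell `(β_W, ε) = (3 / 4, .042)` at `κ = log(6/5)`: `AreaLawOnBallW 2 3 (3 / 8) (log(6/5)) (21 / 250) (21 / 500) mv`,
every `mv ≥ 1`; `ε` maximal at `1/1000` under the certificate form. [folklore] -/
theorem su2_areaLawOnBallW_dim3_frontier_threeQuarters {mv : ℕ} (hmv : 1 ≤ mv) :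
    AreaLawOnBallW 2 3 (3 / 8) (Real.log (6 / 5)) (21 / 250) (21 / 500) mv := by
  have h := su2_areaLawOnBallW_dim3_vertex_of_row (βW := 3 / 4) (ε₀ := 21 / 250) (ε₁ := 21 / 500) (by norm_num) (by norm_num)
    (Real.log_pos (by norm_num)) (by norm_num) hmv
    (rhoFR_two_lt_one_of_bounds (by norm_num) (by norm_num) exp_log_six_fifths_div_two_le
      (exp_le_taylor4 (x := 21 / 250) (by norm_num) (by norm_num)) sqrt_two_le (by norm_num) (by norm_num))
  rw [show (3 / 4 / 2 : ℝ) = 3 / 8 by norm_num] at h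
  exact h

/-- `d = 3` tier-2 vertex FRONTIER cell `(β_W, ε) = (4 / 5, .027)` at `κ = log(6/5)`: `AreaLawOnBallW 2 3 (2 / 5) (log(6/5)) (27 / 500) (27 / 1000) mv`,
every `mv ≥ 1`; `ε` maximal at `1/1000` under the certificate form. [folklore] -/
theorem su2_areaLawOnBallW_dim3_frontier_fourFifths {mv : ℕ} (hmv : 1 ≤ mv) :
    AreaLawOnBallW 2 3 (2 / 5) (Real.log (6 / 5)) (27 / 500) (27 / 1000) mv := by
  have h := su2_areaLawOnBallW_dim3_vertex_of_row (βW := 4 / 5) (ε₀ := 27 / 500) (ε₁ := 27 / 1000) (by norm_num) (by norm_num)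
    (Real.log_pos (by norm_num)) (by norm_num) hmv
    (rhoFR_two_lt_one_of_bounds (by norm_num) (by norm_num) exp_log_six_fifths_div_two_le
      (exp_le_taylor4 (x := 27 / 500) (by norm_num) (by norm_num)) sqrt_two_le (by norm_num) (by norm_num))
  rw [show (4 / 5 / 2 : ℝ) = 2 / 5 by norm_num] at h
  exact h

/-- `d = 3` tier-2 vertex FRONTIER cell `(β_W, ε) = (7 / 8, .008)` at `κ = log(6/5)`: `AreaLawOnBallW 2 3 (7 / 16) (log(6/5)) (2 / 125) (1 / 125) mv`,
every `mv ≥ 1`; `ε` maximal at `1/1000` under the certificate form. [folklore] -/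
theorem su2_areaLawOnBallW_dim3_frontier_sevenEighths {mv : ℕ} (hmv : 1 ≤ mv) :
    AreaLawOnBallW 2 3 (7 / 16) (Real.log (6 / 5)) (2 / 125) (1 / 125) mv := by
  have h := su2_areaLawOnBallW_dim3_vertex_of_row (βW := 7 / 8) (ε₀ := 2 / 125) (ε₁ := 1 / 125) (by norm_num) (by norm_num)
    (Real.log_pos (by norm_num)) (by norm_num) hmv
    (rhoFR_two_lt_one_of_bounds (by norm_num) (by norm_num) exp_log_six_fifths_div_two_le
      (exp_le_taylor4 (x := 2 / 125) (by norm_num) (by norm_num)) sqrt_two_le (by norm_num) (by norm_num))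
  rw [show (7 / 8 / 2 : ℝ) = 7 / 16 by norm_num] at h
  exact h

end Summit.Ventures.YMGap.RobustBall

end
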